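import Literature.NumberTheory.EllipticCurves.FormalExpTaylorUniformizationProofs
import Literature.NumberTheory.EllipticCurves.FormalGroupHasseInvariantProofs
import HarnessLib

/-!
# `log_W`, `exp_W` and the formal leaf commute with base change; the leaf over `ℚ` uniformises
# the local parameters over `ℂ` (proofs only)

Topic `Literature/NumberTheory/EllipticCurves`; a proofs-only file (theorems only). For a
Weierstrass model `V` over a `ℚ`-algebra `A` and a ring homomorphism `φ : A →+* B` of
`ℚ`-algebras: `map φ ω_V = ω_{φV}` (`map_formalOmega'`), `map φ log_V = log_{φV}`
(`map_formalLog`), `map φ exp_V = exp_{φV}` (`map_formalExp`, by uniqueness of the compositional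
inverse), hence the formal leaf `y = exp_{V'}(log_V x)` of Bost's foliation commutes with base
change (`map_formalExp_subst_formalLog`). Consequently, for two elliptic curves `E, E'` over `ℚ`
with Néron period pairs `L₁, L₂` for `E ⊗ ℂ`, `E' ⊗ ℂ`, the RATIONAL series
`y = exp_{E'}(log_E x) ∈ ℚ⟦x⟧` — whose denominators are controlled by
`FormalLeafDenominatorBoundProofs` — satisfies, after `ℚ ⊂ ℂ`,

  `y(𝓣[t₁]) = 𝓣[t₂]`  (`map_leaf_subst_taylor_localParam`),

`tᵢ = -xᵢ/yᵢ` the local parameters along the uniformisations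
(`FormalExpTaylorUniformizationProofs`): the simultaneous-uniformisation hypothesis `hy` of the
tree's André criterion (`Transcendental/AndreCriterionAnalyticProofs`) for the pair
`(φ, ψ) = (t₁, t₂)` and the rational `y`. This closes the formal side of Bost's proof of the
isogeny theorem over `ℚ` (Publ. Math. IHÉS 93 (2001), Cor. 2.5); what remains for the tree is
analytic (pole-clearing on a disc, bounds on a circle, the identity theorem) and the criterion
itself.

## References

* J.-B. Bost, Publ. Math. IHÉS 93 (2001), §3.4.1 and Cor. 2.5. [Bost2001AlgebraicLeaves]
* J. H. Silverman, *AEC* (2009), IV.4–IV.5 (`ω`, `log`, `exp` are defined over `ℤ[a₁,…,a₆] ⊗ ℚ`).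
  [SilvermanAEC2009]
-/

noncomputable section

open PowerSeries
open scoped Topology Nat Classical PeriodPair

/-- The Taylor series of `f : ℂ → ℂ` at `0` (local notation, as in
`AndreCriterionAnalyticProofs`). -/
local notation3 "𝓣[" f "]" =>
  (PowerSeries.mk fun n => ((Nat.factorial n : ℂ)⁻¹ * iteratedDeriv n f 0) : PowerSeries ℂ)

namespace WeierstrassCurve

section Map

variable {A B : Type*} [CommRing A] [CommRing B] [Algebra ℚ A] [Algebra ℚ B] (f : A →+* B)
  (V : WeierstrassCurve A)

/-- `ω` commutes with base change (over `ℚ`-algebras `ω = formalInvDiff`, which has coefficients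
in `ℤ[a₁,…,a₆]`). (The tree's `map_formalOmega` of `UniversalSigmaSpecializationProofs`, re-proved
here from `formalInvDiff_eq_formalOmega` to keep imports light.) [folklore] -/
theorem map_formalOmega' : PowerSeries.map f V.formalOmega = (V.map f).formalOmega := by
  rw [← formalInvDiff_eq_formalOmega, ← formalInvDiff_eq_formalOmega, map_formalInvDiff]

/-- **`log_V` commutes with base change**: `map f log_V = log_{fV}`. [Silverman AEC IV.5]
[folklore] -/
theorem map_formalLog : PowerSeries.map f V.formalLog = (V.map f).formalLog := by
  ext n
  rw [coeff_map]
  rcases n with _ | _ | n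
  · simp [formalLog, coeff_mk]
  · simp [formalLog, coeff_mk]
  · simp only [formalLog, coeff_mk, map_mul, ← map_formalOmega', coeff_map]
    rw [RingHom.map_rat_algebraMap]

/-- **`exp_V` commutes with base change**: `map f exp_V = exp_{fV}` (both are compositional
inverses of `log_{fV}`). [Silverman AEC IV.5] [folklore] -/
theorem map_formalExp : PowerSeries.map f V.formalExp = (V.map f).formalExp := by
  have hL : HasSubst (V.map f).formalLog := (V.map f).hasSubst_formalLog
  have hE : HasSubst (V.map f).formalExp := HasSubst.of_constantCoeff_zero' (V.map f).constantCoeff_formalExp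
  -- `(map f exp_V) ∘ log_{fV} = X`
  have h1 : (PowerSeries.map f V.formalExp).subst (V.map f).formalLog = X := by
    have h : MvPowerSeries.map f (V.formalExp.subst V.formalLog) = MvPowerSeries.map f (X : A⟦X⟧) :=
      congrArg _ V.formalExp_subst_formalLog
    rw [map_subst V.hasSubst_formalLog] at h
    change (PowerSeries.map f V.formalExp).subst (PowerSeries.map f V.formalLog) = PowerSeries.map f X at h
    rwa [map_formalLog, PowerSeries.map_X] at h
  -- hence equal to `exp_{fV}`
  calc PowerSeries.map f V.formalExp
      = (PowerSeries.map f V.formalExp).subst X := (X_subst _).symm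
    _ = (PowerSeries.map f V.formalExp).subst ((V.map f).formalLog.subst (V.map f).formalExp) := by
        rw [formalLog_subst_formalExp]
    _ = PowerSeries.subst (V.map f).formalExp ((PowerSeries.map f V.formalExp).subst (V.map f).formalLog) :=
        (PowerSeries.subst_comp_subst_apply hL hE _).symm
    _ = (V.map f).formalExp := by rw [h1, subst_X hE]

/-- **The formal leaf commutes with base change**: `map f (exp_{V'}(log_V x)) =
exp_{fV'}(log_{fV} x)`. [folklore] -/
theorem map_formalExp_subst_formalLog (V' : WeierstrassCurve A) :
    PowerSeries.map f (V'.formalExp.subst V.formalLog) =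
      (V'.map f).formalExp.subst (V.map f).formalLog := by
  change MvPowerSeries.map f (V'.formalExp.subst V.formalLog) = _
  rw [map_subst V.hasSubst_formalLog]
  change (PowerSeries.map f V'.formalExp).subst (PowerSeries.map f V.formalLog) = _
  rw [map_formalExp, map_formalLog]

end Map

/-! ### The rational leaf uniformises the complex local parameters -/

/-- **`y(𝓣[t₁]) = 𝓣[t₂]` for the RATIONAL leaf `y = exp_{E'}(log_E x) ∈ ℚ⟦x⟧`** of two elliptic
curves `E, E'` over `ℚ` (any Weierstrass models `W₀, W₀'`), read in `ℂ⟦x⟧`, where `tᵢ = -xᵢ/yᵢ`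
are the local parameters along the uniformisations of `E ⊗ ℂ`, `E' ⊗ ℂ` by Néron period pairs
`L₁, L₂` (`g₂ = c₄/12`, `g₃ = c₆/216`): the hypothesis `hy` of André's criterion for
`(φ, ψ) = (t₁, t₂)` and the series `y` whose denominators `FormalLeafDenominatorBoundProofs`
bounds. [cite: Bost2001AlgebraicLeaves, Cor. 2.5 (proof) and §3.4.1] -/
theorem map_leaf_subst_taylor_localParam (W₀ W₀' : WeierstrassCurve ℚ) (L₁ L₂ : PeriodPair)
    (h₁₂ : L₁.g₂ = (W₀.baseChange ℂ).c₄ / 12) (h₁₃ : L₁.g₃ = (W₀.baseChange ℂ).c₆ / 216)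
    (h₂₂ : L₂.g₂ = (W₀'.baseChange ℂ).c₄ / 12) (h₂₃ : L₂.g₃ = (W₀'.baseChange ℂ).c₆ / 216) :
    PowerSeries.subst
        𝓣[(fun z => if z ∈ L₁.lattice then (0 : ℂ) else
          -(℘[L₁] z - (W₀.baseChange ℂ).b₂ / 12) /
            ((℘'[L₁] z - (W₀.baseChange ℂ).a₁ * (℘[L₁] z - (W₀.baseChange ℂ).b₂ / 12) -
              (W₀.baseChange ℂ).a₃) / 2))]
        (PowerSeries.map (algebraMap ℚ ℂ) (W₀'.formalExp.subst W₀.formalLog)) =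
      𝓣[(fun z => if z ∈ L₂.lattice then (0 : ℂ) else
          -(℘[L₂] z - (W₀'.baseChange ℂ).b₂ / 12) /
            ((℘'[L₂] z - (W₀'.baseChange ℂ).a₁ * (℘[L₂] z - (W₀'.baseChange ℂ).b₂ / 12) -
              (W₀'.baseChange ℂ).a₃) / 2))] := by
  rw [map_formalExp_subst_formalLog]
  exact formalExp_subst_formalLog_subst_taylor L₁ L₂ (W₀.baseChange ℂ) (W₀'.baseChange ℂ)
    h₁₂ h₁₃ h₂₂ h₂₃

end WeierstrassCurve

end
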